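import Literature.AlgebraicGeometry.AbelianSchemes.AbelianLiftOfClosedFibreCount
import Literature.AlgebraicGeometry.AbelianSchemes.CechH1CountOfPoincareDataHead
import HarnessLib

/-!
# Abelian schemes whose closed fibre carries the DUALS letter's data lift along `A → A⧸J₀` when `2 ∈ A^×` — UNCONDITIONALLY
# ([Oort1971] Thm. (2.2.1), first proof, per instance ∘ [MumfordAV1970] §13 Cor. 2 for the letter's data)

Layer `Literature/AlgebraicGeometry/AbelianSchemes`, namespace `Literature.AlgebraicGeometry.AbelianSchemes.AbelianSchemeOver`.
PROOF FILE (cell `hodgecm-mathlib`, P6 «MOD programme» sub-desk P6b, (U-ab) plate organ **(O8c) «ABELIAN LIFT WHEN 2 IS A UNIT, DUALS-LETTER REGIME»**,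
desk F0P6b-plan (g11); count-neutral ★ capital on `--supports stmt-HodgeConjecture-24832`; THEOREMS ONLY: no definition, no instance, no notation, no
named fact, no `sorry`).

**(O8c) `exists_abelianLift_of_isUnit_two_of_closedFibreLetter`.**  `A` Artinian local, `2 ∈ A^×`, `J₀ ≠ ⊤`, `X₀` abelian of relative dimension `g` over
`Spec (A⧸J₀)` whose canonical closed fibre `X₀ ⊗ κ(A)` carries the DUALS letter's data of ★ `MumfordDual` (projective — kept as a binder in the letter's
shape —, a rank-one `M` rigidified along the unit section with ample class on every geometric fibre, `n ∈ κ(A)^×` killing `K(M)`; the separably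
polarised regime) ⇒ `X₀` lifts to an abelian scheme of relative dimension `g` over `Spec A` (★ `IsBaseChangeVia`) — NO `H¹` hypothesis: the one count
(O8a) needs is ★ `MumfordDual.finite_finrank_cechH1_eq_dim_of_letter_field` ([MumfordAV1970] §13 Cor. 2 for the letter's data over any field, any
characteristic).  **(O8d) `exists_abelianLift_of_isUnit_two_of_letter`** — the same with the letter's data given ON `X₀` OVER ITS OWN BASE
`Spec (A⧸J₀)` (`X₀` projective, `L` rank one rigidified along `ε` with ample class on geometric fibres, `n ∈ (A⧸J₀)^×` killing `K(L)`: the shape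
★ `MumfordDual.hH1_of_letter` consumes for abelian schemes over Noetherian rings, and the shape a polarised moduli point delivers), carried to the
closed fibre along ★ `baseChange_isBaseChangeVia` by ★ (K′) `exists_kOfL_etale_of_isUnit` ∕ `hasRank_pullback` ∕ `IsBaseChangeVia.pullback_unitSection_
detClass_pullback_eq_one` ∕ `IsBaseChangeVia.exists_isAmple_cechClass_fibre_pullback` ∕ `IsBaseChangeVia.pow_eq_one_of_memKOfL_pullback` (verbatim the
transport of ★ `hH1_of_letter`) and `IsProjective.pullback_snd`.  Kept apart from ★ (O8) `AbelianLiftOfClosedFibreCount` only to spare that file the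
`MumfordDual` import cone.  NOT HERE (interface currency, LEAD M-1 ∕ desk P6a): the letter's `hkill` for `L = L^Δ(λ)` of a polarisation `λ` of type `δ`
with `2·∏ δᵢ ∈ (A⧸J₀)^×` over a NON-REDUCED base (★ `PolarizationKernelPairMulN` is stated for `[IsReduced S]`; ★ `LDeltaRigidifiedFibrewiseAmple` already
gives `hL ∕ hε ∕ hΘ` for `L^Δ(λ)`).

HC_CM is proved only modulo the printed citations (2 remaining named inputs) until rung 0 closes; nothing here bears on a summit statement.
## References
* [Oort1971] F. Oort, *Finite group schemes, local moduli for abelian varieties, and lifting problems*, Compositio Math. 23 (1971), Thm. (2.2.1)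
  (p. 273) and its first proof (pp. 277–280).
* [MumfordAV1970] D. Mumford, *Abelian Varieties* (1970), §13 (p. 123), §13 Theorem (p. 125), §13 Cor. 2 (p. 129), §23 (p. 231).
* [MumfordFogartyKirwan1994] D. Mumford, J. Fogarty, F. Kirwan, *Geometric Invariant Theory*, 3rd ed. (1994), Ch. 6 §1 Cor. 6.8 (p. 118), §2 (p. 121),
  §3 Proposition 6.15 (p. 124); Ch. 7 §2 Definition 7.2 (p. 129).
-/

noncomputable section

set_option backward.isDefEq.respectTransparency false

open CategoryTheory CategoryTheory.Limits AlgebraicGeometry IsLocalRing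
open Literature.AlgebraicGeometry.Morphisms

namespace Literature.AlgebraicGeometry.AbelianSchemes.AbelianSchemeOver

variable {A : Type} [CommRing A] [IsArtinianRing A] [IsLocalRing A]

open scoped MonObj in -- `u ^ n = 1` in the monoid `T ⟶ X` of points of the group object (the letter's `hkill` shape)
/-- **(O8c) — UNCONDITIONAL for `X₀` whose canonical closed fibre carries the DUALS letter's data** (projective — automatic for an abelian variety, kept as
a binder in the letter's shape —, a rank-one `M` rigidified along the unit section with ample class on every geometric fibre, `n ∈ κ(A)^×` killing `K(M)`):
the count `dim_{κ(A)} Ȟ¹(𝔙, 𝒪) = dim` is ★ `MumfordDual.finite_finrank_cechH1_eq_dim_of_letter_field` ([MumfordAV1970] §13 Cor. 2 for the letter's data, ANY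
characteristic), so ★ (O8a) applies.  This is the Row-4 regime (PEL points: polarisation of degree prime to `p`).
[cite: Oort1971, Theorem (2.2.1) (p. 273) and pp. 277–280] [cite: MumfordAV1970, §13 Cor. 2 (p. 129), §13 Theorem (p. 125) and §23 (p. 231)]
[cite: MumfordFogartyKirwan1994, Ch. 6 §1 Cor. 6.8 (p. 118), Ch. 6 §3 Proposition 6.15 (p. 124)] -/
theorem exists_abelianLift_of_isUnit_two_of_closedFibreLetter (J₀ : Ideal A) (hJ₀ : J₀ ≠ ⊤) {g : ℕ} (h2 : IsUnit (2 : A))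
    (X₀ : AbelianSchemeOver (Spec (.of (A ⧸ J₀)))) (hg : X₀.IsOfRelDim g)
    (hB : Morphisms.IsProjective (closedFibre hJ₀ X₀).X.hom) (M : (closedFibre hJ₀ X₀).left.Modules) (hM : Motives.HasRank M 1)
    (hεM : Modules.CechPic.pullback (closedFibre hJ₀ X₀).unitSection (Modules.detClass (Modules.HasRank.isFiniteLocallyFree' hM)) = 1)
    (hΘM : ∀ ⦃Ω : Type⦄ [Field Ω] [IsAlgClosed Ω] (t : Spec (.of Ω) ⟶ Spec (.of (ResidueField A))),
      ∃ Θ : Motives.CartierDivisor ((closedFibre hJ₀ X₀).fibre t).toAbelianVariety.X.left, Θ.IsAmple ∧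
        Modules.CechPic.pullback (X := ((closedFibre hJ₀ X₀).fibre t).toAbelianVariety.X.left) (pullback.fst (closedFibre hJ₀ X₀).X.hom t)
          (Modules.detClass (Modules.HasRank.isFiniteLocallyFree' hM)) = Θ.cechClass)
    (n : ℕ) [NeZero n] (hn : IsUnit ((n : ℕ) : ResidueField A))
    (hkillM : ∀ (T : Over (Spec (.of (ResidueField A)))) (u : T ⟶ (closedFibre hJ₀ X₀).X), (closedFibre hJ₀ X₀).MemKOfL M u → u ^ n = 1) :
    ∃ (X : AbelianSchemeOver (Spec (.of A))) (_ : X.IsOfRelDim g) (G : X₀.X.left ⟶ X.X.left),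
      X₀.IsBaseChangeVia X (Spec.map (CommRingCat.ofHom (Ideal.Quotient.mk J₀))) G := by
  refine exists_abelianLift_of_isUnit_two_of_closedFibreCount J₀ hJ₀ h2 X₀ hg (fun W hW hWcov => ?_)
  exact (MumfordDual.finite_finrank_cechH1_eq_dim_of_letter_field (ResidueField A) (closedFibre hJ₀ X₀) hB M hM hεM hΘM n hn hkillM
    W hW hWcov).2.ge.trans (Nat.le_succ _)

open scoped MonObj in -- `u ^ n = 1` in the monoid of points of the group object
/-- **(O8d) — UNCONDITIONAL (U) for `X₀` carrying the DUALS letter's data OVER ITS OWN BASE `Spec (A⧸J₀)`** (the shape in which the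
DUALS road ∕ a PEL point delivers them: ★ `MumfordDual.hH1_of_letter`'s `(hA, L, hL, hε, hΘ, n, hn, hkill)` for an abelian scheme over a Noetherian
ring).  `A` Artinian local with `2 ∈ A^×`, `J₀ ≠ ⊤`, `X₀ → Spec (A⧸J₀)` projective abelian of relative dimension `g` with a rank-one `L` rigidified
along the unit section, of ample class on every geometric fibre, and `n ∈ (A⧸J₀)^×` killing `K(L)` ⇒ `X₀` lifts to `Spec A`.  The letter is carried
to the canonical closed fibre `X₀ ⊗ κ(A)` along the base-change square ★ `baseChange_isBaseChangeVia` exactly as in ★ `MumfordDual.hH1_of_letter`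
(★ `exists_kOfL_etale_of_isUnit` (K′), `hasRank_pullback`, `IsBaseChangeVia.pullback_unitSection_detClass_pullback_eq_one`,
`IsBaseChangeVia.exists_isAmple_cechClass_fibre_pullback`, `IsBaseChangeVia.pow_eq_one_of_memKOfL_pullback`; projectivity by `IsProjective.pullback_snd`),
then (O8c).
[cite: Oort1971, Theorem (2.2.1) (p. 273) and pp. 277–280] [cite: MumfordAV1970, §13 Cor. 2 (p. 129), §13 (p. 123), §23 (p. 231)]
[cite: MumfordFogartyKirwan1994, Ch. 6 §2 (p. 121), Ch. 7 §2 Definition 7.2 (p. 129)] -/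
theorem exists_abelianLift_of_isUnit_two_of_letter (J₀ : Ideal A) (hJ₀ : J₀ ≠ ⊤) {g : ℕ} (h2 : IsUnit (2 : A))
    (X₀ : AbelianSchemeOver (Spec (.of (A ⧸ J₀)))) (hg : X₀.IsOfRelDim g)
    (hP : Morphisms.IsProjective X₀.X.hom) (L : X₀.left.Modules) (hL : Motives.HasRank L 1)
    (hε : Modules.CechPic.pullback X₀.unitSection (Modules.detClass (Modules.HasRank.isFiniteLocallyFree' hL)) = 1)
    (hΘ : ∀ ⦃Ω : Type⦄ [Field Ω] [IsAlgClosed Ω] (s : Spec (.of Ω) ⟶ Spec (.of (A ⧸ J₀))),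
      ∃ Θ : Motives.CartierDivisor (X₀.fibre s).toAbelianVariety.X.left, Θ.IsAmple ∧
        Modules.CechPic.pullback (X := (X₀.fibre s).toAbelianVariety.X.left) (pullback.fst X₀.X.hom s)
          (Modules.detClass (Modules.HasRank.isFiniteLocallyFree' hL)) = Θ.cechClass)
    (n : ℕ) [NeZero n] (hn : IsUnit ((n : ℕ) : A ⧸ J₀))
    (hkill : ∀ (T : Over (Spec (.of (A ⧸ J₀)))) (u : T ⟶ X₀.X), X₀.MemKOfL L u → u ^ n = 1) :
    ∃ (X : AbelianSchemeOver (Spec (.of A))) (_ : X.IsOfRelDim g) (G : X₀.X.left ⟶ X.X.left),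
      X₀.IsBaseChangeVia X (Spec.map (CommRingCat.ofHom (Ideal.Quotient.mk J₀))) G := by
  -- (K′) on `Spec (A⧸J₀)` (Artinian, hence Noetherian): `K(L)` represented, killed by `n`
  obtain ⟨Z, i, -, -, -, hin, hZ⟩ := X₀.exists_kOfL_etale_of_isUnit hL hε hn hkill hΘ
  -- the canonical closed fibre as a base change of group schemes
  have hbc : (closedFibre hJ₀ X₀).IsBaseChangeVia X₀ (residueBaseMap hJ₀) (closedFibreι hJ₀ X₀) :=
    X₀.baseChange_isBaseChangeVia (residueBaseMap hJ₀)
  have hB : Morphisms.IsProjective (closedFibre hJ₀ X₀).X.hom := by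
    change Morphisms.IsProjective (X₀.baseChange (residueBaseMap hJ₀)).X.hom
    rw [AbelianSchemeOver.baseChange_hom]
    exact hP.pullback_snd _
  have hn' : IsUnit ((n : ℕ) : ResidueField A) := by
    have h := hn.map (Ideal.Quotient.factor (IsLocalRing.le_maximalIdeal hJ₀))
    rwa [map_natCast] at h
  exact exists_abelianLift_of_isUnit_two_of_closedFibreLetter J₀ hJ₀ h2 X₀ hg hB _
    (Modules.hasRank_pullback (closedFibreι hJ₀ X₀) hL) (hbc.pullback_unitSection_detClass_pullback_eq_one hL hε)
    (fun Ω _ _ t => hbc.exists_isAmple_cechClass_fibre_pullback hL hΘ t) n hn'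
    (fun T u hu => hbc.pow_eq_one_of_memKOfL_pullback hL i hZ hin u hu)

end Literature.AlgebraicGeometry.AbelianSchemes.AbelianSchemeOver

end
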